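import Literature.MathematicalPhysics.QuantumFieldTheory.Balaban1983to89.B6Ineq2134KFamKLevelTorusIn
import Literature.MathematicalPhysics.QuantumFieldTheory.Balaban1983to89.B6RandomWalkInputNormChain

/-!
# `Balaban1983to89.B6Ineq2134RightFactorA` — T. Bałaban, *Propagators and renormalization transformations for lattice gauge theories. II*,
# Commun. Math. Phys. **96** (1984) 223–250 [Balaban1984PropagatorsII], (2.134) p. 247 *"|(K_{□,□′}G_{□′}h_{□′}J)(x)| ≤ O(M⁻¹)e^{−½δ₂d(y,y′)}|J|"* READ
# *"in the norms appearing in the inequalities (2.136)–(2.140)"* (p. 247, after (2.141)): THE KERNELS (2.92)/(2.93) COMPOSED WITH AN ABSTRACT RIGHT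
# FACTOR ON AN ARBITRARY ADMISSIBLE INPUT CLASS — the lines 1–4 of (2.92), the off-diagonal kernel (2.93), their assembly and the torus wrappers of
# r03's `…B6Ineq2134DiagIn` / `…B6Ineq2134OffDiag` / p38's `…B6Ineq2134KFamKLevelTorusIn`, with the right factor `G_{□′}h_{□′}` REPLACED by any operator
# `X` carrying a majorant of the (2.133) shape for an admissible input class (the last legs `G_{□′}h_{□′}∇*_ν` of (2.138) on Hölder inputs)

statement-level skeleton of published theorems with citation tags; proofs where landed; nothing here is a claim about the Yang–Mills mass gap

WHAT IS PRINTED (p. 239 [PDF 17], p. 247 [PDF 25]): *"K_{□,□}(x, x′) = h_□Δ^η − Δ^ηh_□ + a_k(L^kη)^{−2}(h_□Q_k*Q_k − Q_k*Q_kh_□) + ζ_□∂^η(P(Ω) − P_□)∂^{η*}h_□ +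
ζ_□P_{□,1}(∂^ηh_□) (2.92) … K_{□,□′} = h_□²(1 − ζ_□)∂^ηP(Ω)∂^{η*}h_{□′} (2.93) … |(K_{□,□′}G_{□′}h_{□′}J)(x)| ≤ O(M⁻¹)e^{−½δ₂d(y,y′)}|J| (2.134) … The
operator G can be represented as G = G₀(I − R)⁻¹ = Σ G₀Rⁿ (2.141) and the series above is convergent in the norms appearing in the inequalities
(2.136)–(2.140)."*

CITATION HEADER (lean-in-tree rule) — WHAT IS REPRODUCED.  Cell `pub-ymgap`, seat `pub-ymgap-dag-n03-b` (FIRST-MISSING-ESTIMATE for DAG node N03 = [B6]: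
the census slot `c3` = (2.138) of r03's `…B6Prop26PrintedStage2KLevelV1.prop26Printed_kLevel_of_slots5`; file 2 of the (2.138) programme after
`…B6Ineq2138KLevelSkeletonV1`).  THE POINT.  In the walk (2.141) for `∇G∇*` the last legs are `K_{□,□′}G_{□′}h_{□′}∇*_ν` acting on inputs `J` measured by
`‖J‖^{ξ′}_ε + |J|`; every line of (2.92)/(2.93) is a SUP-majorised LEFT factor (`c₀`, `ζ·[N_k, h]`, `ζ(∂P∂* − P_□)h`, `h²(1 − ζ′)∂P∂*`) composed with the right
factor `X = G_{□′}h_{□′}∇*_ν` — except the first-order part of line 1 (`c_e·E_e·X`, two differences on `G_{□′}`: the member (1.112) of [Balaban1984PropagatorsI]),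
which is kept as an OPAQUE letter per `e`.  So r03's proofs go through VERBATIM with `…B6RandomWalkInputNorm.hasMajorant_mul_hasMajorantA` ((2.52) for an
admissible-input right factor) in place of `…hasMajorant_mul`, the input weight `Q(y′)` of `X` riding along:
* §1 (any block geometry, any input class `adm` with nonnegative sizes) `hasMajorantA_mulOp_left_weight`; **`line1_hasMajorantA`** (`(Σ_e c_eE_e − c₀)·X`
  from opaque `E`-letters `θ_E·e^{−δd}·Q` and `|c₀| ≤ s₂/(M·len²)`); **`commLine_hasMajorantA`** (r03's `hasMajorant_comm_inout` ∘ `X`, `term_comm_le`,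
  `sum_le`); **`domLine_hasMajorantA`**; **`offDiag_hasMajorantA`**; **`diag_hasMajorantA`** (the three lines together);
* §2 (the genuine multi-level torus `geomTB D`, ONE threshold, ONE constant) **`ineq2134A_diag_torus`**, **`ineq2134A_kDiag_torus`** (`K_{□,□} = kDiag` by
  name through the member's `hdec`), **`ineq2134A_kOff_torus`** (`K_{□,□′} = kOff`), **`h2134A_kFam_torus`** (all pairs: `(K_{□,□′}·G_{□′})·X′_{□′}` for a
  family of right factors `X′_{□′}` — at k levels `X′_{□′} = h_{□′}∇*_ν` after `G_{□′}` — with the majorant `Θ·(C_PC_G/m + U)/M·e^{−(δ/2)d(y,y′)}·Q(y′)`).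
IMPORTS BY NAME, restating nothing: `…B6Ineq2134Diag` (`term_comm_le`), `…B6Ineq2134DiagIn` (`hasMajorant_comm_inout`), `…B6Ineq2134OffDiag` (`term_le`,
`sum_le`, `theta_le`), `…B6Ineq2134DiagKLevel` (`theta_pack_le`), `…B6Ineq2134KLevelTorus` (`ineq263_geomTB`, `thr_geomTB`, side facts of `geomTB`),
`…B6RandomWalkInputNorm(Chain)` (`HasMajorantA`, `hasMajorant_mul_hasMajorantA`, `hasMajorantA_localise_out`), `…B6Grad2LegLettersKLevelV1.hasMajorantA_mulOp_left`
is re-proved in two lines (not imported: that module carries the cube).  THEOREMS ONLY (no `def`, no `def … : Prop`, no new hypothesis-shaped fact); standard axioms.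

HONEST SCOPE / DIVERGENCES.  (1) Pure bookkeeping over an abstract block geometry / the torus census geometry: no operator of the paper is constructed;
the analytic inputs (the `X`-letter of `G_{□′}h_{□′}∇*_ν`, the line-1 `E`-letters from (1.112)) are the subject of the next file of this seat.  (2) As in
r03's files: the rate bookkeeping (⅛, ¾, ⅓, ½) and all constants are ours (*"The choice of factors is again arbitrary"*, p. 238); `∂P∂*` is a displayed
hypothesis; lattice units; constants `L`-dependent, `k`/`M_h`-independent.  (3) The input class is arbitrary (sizes `≥ 0`); no Hölder norm appears here.
Nothing on d = 4 or the continuum; NOT a node discharge; NOT summit progress.  Unit `pub-ymgap-dag-n03-b` (gen 0), 2026-08-25.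
-/

open scoped BigOperators
open Finset

namespace Literature.MathematicalPhysics.QuantumFieldTheory.Balaban1983to89.B6Ineq2134RightFactorA

open B6RandomWalk (HasMajorant BlockSupp hasMajorant_mono)
open B6RandomWalkInputNorm (HasMajorantA hasMajorantA_mono hasMajorantA_add hasMajorantA_neg hasMajorantA_sub hasMajorantA_finsetSum
  hasMajorant_mul_hasMajorantA)
open B6RandomWalkInputNormChain (hasMajorantA_localise_out)
open B6Prop26Gluing (mulOp mulOp_apply OutLoc outLoc_mulOp_mul outLoc_mul ind ind_nonneg ind_le_one ind_of_mem ind_of_not_mem LocalMajorant)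
open B6InMajorantTransplant (InMajorant)
open B6Ineq268 (LevelSep)
open B6Lemma21Repaired (Ineq263With)
open B6Ineq2134Diag (term_comm_le)
open B6Ineq2134DiagIn (hasMajorant_comm_inout)
open B6Ineq2134OffDiag (term_le sum_le theta_le)
open B6Ineq2134DiagKLevel (theta_pack_le)
open B6MultiLevelTorusOperator (TDomains)
open B8Ineq192MultiLevelTorus (geomTB geomTB_L geomTB_M levelSepTB)
open B6Ineq2134KLevelTorus (one_le_L_TB eta_pos_TB M_pos_TB one_le_RLMh RM_nonneg_TB dist_nonneg_TB ineq263_geomTB thr_geomTB)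
open B6Ineq261LevelGap (K261 K261_nonneg)
open B6Eq291Generator (kDiag kOff kFam)

noncomputable section

/-! ## §1  The lines of (2.92)/(2.93) against an abstract right factor on an admissible input class -/

section Generic

variable {g : B6.Geometry} {X : Type} (blk : X → g.Site) {adm : (X → ℝ) → g.Site → ℝ → Prop}

/-- a bounded left factor: `|f| ≤ 1` keeps every admissible-input majorant (`…B6Grad2LegLettersKLevelV1.hasMajorantA_mulOp_left`, re-proved).
[cite: Balaban1984PropagatorsII, (2.92) p.239 (ζ_□), bookkeeping] -/
theorem hasMajorantA_mulOp_left {T : Module.End ℝ (X → ℝ)} {f : X → ℝ} {K : g.Site → g.Site → ℝ} (hfle : ∀ x, |f x| ≤ 1)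
    (hT : HasMajorantA blk adm T K) : HasMajorantA blk adm (mulOp f * T) K := by
  intro y' μ B hμ x
  rw [Module.End.mul_apply, mulOp_apply, abs_mul]
  calc |f x| * |T μ x| ≤ 1 * (K (blk x) y' * B) := mul_le_mul (hfle x) (hT y' μ B hμ x) (abs_nonneg _) zero_le_one
    _ = K (blk x) y' * B := one_mul _

/-- **A WEIGHTED LEFT MULTIPLIER**: `|f(x)| ≤ a(y(x))` and `T ≺_adm K` give `f·T ≺_adm a(y)·K(y,y′)` (the coefficient `c₀ = (Δh_□)(x)` of (2.92) line 1).
[cite: Balaban1984PropagatorsII, (2.92) p.239 (line 1), bookkeeping] -/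
theorem hasMajorantA_mulOp_left_weight {T : Module.End ℝ (X → ℝ)} {f : X → ℝ} {K : g.Site → g.Site → ℝ} {a : g.Site → ℝ}
    (hf : ∀ x, |f x| ≤ a (blk x)) (hT : HasMajorantA blk adm T K) : HasMajorantA blk adm (mulOp f * T) (fun y y' => a y * K y y') := by
  intro y' μ B hμ x
  rw [Module.End.mul_apply, mulOp_apply, abs_mul]
  have h0 : 0 ≤ a (blk x) := (abs_nonneg _).trans (hf x)
  calc |f x| * |T μ x| ≤ a (blk x) * (K (blk x) y' * B) := mul_le_mul (hf x) (hT y' μ B hμ x) (abs_nonneg _) h0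
    _ = a (blk x) * K (blk x) y' * B := by ring

/-- **LINE 1 OF (2.92) AGAINST AN ABSTRACT RIGHT FACTOR** `X` on the class `adm`: the first-order pieces `c_e·E_e·X` are OPAQUE letters
`θ_E/M·e^{−δ₂d}·Q(y′)` (at k levels: two differences on the member `G_{□′}`, the member (1.112) on Hölder inputs), the zeroth-order piece `c₀·X` is the weighted
multiplier `|c₀| ≤ s₂/(M·len²)` against the (2.133)-shape majorant `C_G·len²·e^{−δ₂d}·Q` of `X` — `(Σ_e c_eE_e − c₀)·X ≺_adm (#D·θ_E + s₂C_G)/M·e^{−δ₂d}·Q`.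
[cite: Balaban1984PropagatorsII, (2.134) p.247, (2.92) p.239 (line 1), (2.141) p.247] -/
theorem line1_hasMajorantA (hL : 0 < g.L) (hη : 0 < g.eta) (hM : 0 < g.M) {δ₂ CG s₂ θE : ℝ}
    {ι : Type} (D : Finset ι) {E : ι → Module.End ℝ (X → ℝ)} {c : ι → X → ℝ} {c₀ : X → ℝ} {XR : Module.End ℝ (X → ℝ)}
    {Q : g.Site → ℝ} (hadm : ∀ (μ : X → ℝ) (y' : g.Site) (B : ℝ), adm μ y' B → 0 ≤ B)
    (hE : ∀ i ∈ D, HasMajorantA blk adm (mulOp (c i) * E i * XR) fun y y' => θE / g.M * Real.exp (-(δ₂ * g.dist y y')) * Q y')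
    (hc₀ : ∀ x, |c₀ x| ≤ s₂ / (g.M * g.len (blk x) ^ 2))
    (hX : HasMajorantA blk adm XR fun y y' => CG * g.len y ^ 2 * Real.exp (-(δ₂ * g.dist y y')) * Q y') :
    HasMajorantA blk adm ((∑ i ∈ D, mulOp (c i) * E i - mulOp c₀) * XR) fun y y' =>
      (D.card * θE + s₂ * CG) / g.M * Real.exp (-(δ₂ * g.dist y y')) * Q y' := by
  classical
  have hlen : ∀ z : g.Site, 0 < g.len z := fun z => mul_pos (pow_pos hL _) hη
  -- distribute the right factor
  have e : (∑ i ∈ D, mulOp (c i) * E i - mulOp c₀) * XR = ∑ i ∈ D, mulOp (c i) * E i * XR - mulOp c₀ * XR := by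
    rw [sub_mul, Finset.sum_mul]
  rw [e]
  have hsum := hasMajorantA_finsetSum blk D (fun i => mulOp (c i) * E i * XR) _ hE
  have h0 := hasMajorantA_mulOp_left_weight blk (a := fun y => s₂ / (g.M * g.len y ^ 2)) hc₀ hX
  refine hasMajorantA_mono blk (hasMajorantA_sub blk hsum h0) hadm fun y y' => ?_
  have hy : g.len y ≠ 0 := (hlen y).ne'
  have hMne : g.M ≠ 0 := hM.ne'
  have ecan : s₂ / (g.M * g.len y ^ 2) * (CG * g.len y ^ 2 * Real.exp (-(δ₂ * g.dist y y')) * Q y') =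
      s₂ * CG / g.M * Real.exp (-(δ₂ * g.dist y y')) * Q y' := by field_simp
  show ∑ i ∈ D, θE / g.M * Real.exp (-(δ₂ * g.dist y y')) * Q y' + s₂ / (g.M * g.len y ^ 2) * (CG * g.len y ^ 2 * Real.exp (-(δ₂ * g.dist y y')) * Q y')
    ≤ (D.card * θE + s₂ * CG) / g.M * Real.exp (-(δ₂ * g.dist y y')) * Q y'
  rw [ecan, Finset.sum_const, nsmul_eq_mul]
  have : ↑D.card * (θE / g.M * Real.exp (-(δ₂ * g.dist y y')) * Q y') + s₂ * CG / g.M * Real.exp (-(δ₂ * g.dist y y')) * Q y' =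
      (D.card * θE + s₂ * CG) / g.M * Real.exp (-(δ₂ * g.dist y y')) * Q y' := by
    field_simp
  rw [this]

/-- **A COMMUTATOR LINE OF (2.92) (lines 2, 4) AGAINST AN ABSTRACT RIGHT FACTOR**: the partner `N` (`Q*a_□Q`, `∂P_□∂*`) with In- and Out-localised majorants
`C_N(L^jη)^{−2}e^{−δ₂d}` over the set `T` carrying `supp h_□`, the block-Lipschitz `h_□`, a cut-off `|z| ≤ 1`, and `X ≺_adm C_G·len²·e^{−δ₂d}·Q`:
`z·(Nh_□ − h_□N)·X ≺_adm (s/M)·C_NC_GL²(8/δ₂ + r₀)c²·e^{−½δ₂d}·Q` (r03's `commLine_hasMajorant_inout`, the composition (2.52) taken on the class).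
[cite: Balaban1984PropagatorsII, (2.134) p.247 + (2.92) p.239 (lines 2, 4) + (2.141) p.247 + p.238] -/
theorem commLine_hasMajorantA (hL : 1 ≤ g.L) (hη : 0 < g.eta) (hsep : LevelSep g)
    (hd : ∀ a b, 0 ≤ g.dist a b) {δ₂ CN CG c s r₀ : ℝ} (hδ₂ : 0 < δ₂) (hCN : 0 ≤ CN) (hCG : 0 ≤ CG)
    (hs : 0 ≤ s) (hr₀ : 0 ≤ r₀) (hM : 0 < g.M) (hRM : 0 ≤ g.R * g.M)
    (hthr : g.L ^ 2 ≤ Real.exp (1 / 8 * δ₂ * (g.R * g.M))) (h263 : Ineq263With c g (3 / 4 * δ₂) (1 / 3))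
    {N XR : Module.End ℝ (X → ℝ)} {z hc : X → ℝ} {T : Set g.Site}
    (hNin : InMajorant blk N T fun y y'' => CN / g.len y ^ 2 * Real.exp (-(δ₂ * g.dist y y'')))
    (hNout : ∀ (y'' : g.Site) (μ : X → ℝ) (B : ℝ), BlockSupp blk μ y'' B → ∀ x, blk x ∈ T →
      |N μ x| ≤ CN / g.len (blk x) ^ 2 * Real.exp (-(δ₂ * g.dist (blk x) y'')) * B)
    (hz : ∀ x, |z x| ≤ 1) (hcT : ∀ x, hc x ≠ 0 → blk x ∈ T)
    (hLip : ∀ x x', |hc x' - hc x| ≤ s / g.M * (g.dist (blk x) (blk x') + r₀))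
    {Q : g.Site → ℝ} (hQ : ∀ y, 0 ≤ Q y) (hadm : ∀ (μ : X → ℝ) (y' : g.Site) (B : ℝ), adm μ y' B → 0 ≤ B)
    (hX : HasMajorantA blk adm XR fun y'' y' => CG * g.len y'' ^ 2 * Real.exp (-(δ₂ * g.dist y'' y')) * Q y') :
    HasMajorantA blk adm (mulOp z * (N * mulOp hc - mulOp hc * N) * XR) fun y y' =>
      s / g.M * (CN * CG * g.L ^ 2 * (8 / δ₂ + r₀)) * c ^ 2 * Real.exp (-(1 / 2 * δ₂ * g.dist y y')) * Q y' := by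
  classical
  have hL0 : 0 < g.L := zero_lt_one.trans_le hL
  have hlen : ∀ z : g.Site, 0 < g.len z := fun z => mul_pos (pow_pos hL0 _) hη
  -- (1) the commutator with the block-Lipschitz `h_□` (sup majorant, r03)
  have hlipnn : ∀ y y'' : g.Site, 0 ≤ s / g.M * (g.dist y y'' + r₀) := fun y y'' => by
    have := hd y y''
    positivity
  have hKN : ∀ y y'' : g.Site, 0 ≤ CN / g.len y ^ 2 * Real.exp (-(δ₂ * g.dist y y'')) := fun y y'' => by
    have := hlen y
    positivity
  have hcomm := hasMajorant_comm_inout blk hKN hNin hNout hcT (lip := fun y y'' => s / g.M * (g.dist y y'' + r₀)) hlipnn hLip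
  -- (2) the composition on the class and the cut-off
  have hKX : ∀ a b : g.Site, 0 ≤ CG * g.len a ^ 2 * Real.exp (-(δ₂ * g.dist a b)) * Q b := fun a b => by
    have := hQ b
    positivity
  have hmul := hasMajorant_mul_hasMajorantA blk hcomm hX hKX hadm
  have hzT := hasMajorantA_mulOp_left blk (f := z) hz hmul
  rw [mul_assoc (mulOp z)]
  refine hasMajorantA_mono blk hzT hadm fun y y' => ?_
  -- (3) the pointwise bound: the weight `Q(y′)` rides along r03's `term_comm_le` and `sum_le`
  have hterm : ∀ y'' : g.Site,
      s / g.M * (g.dist y y'' + r₀) * (CN / g.len y ^ 2 * Real.exp (-(δ₂ * g.dist y y''))) *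
        (CG * g.len y'' ^ 2 * Real.exp (-(δ₂ * g.dist y'' y')) * Q y') ≤
      s / g.M * (CN * CG * g.L ^ 2 * (8 / δ₂ + r₀)) *
        (Real.exp (-(3 / 4 * δ₂ * g.dist y y'')) * Real.exp (-(3 / 4 * δ₂ * g.dist y'' y'))) * Q y' := by
    intro y''
    have ht := term_comm_le hL hη hsep hd hδ₂ hCN hCG hs hr₀ hM hRM hthr y y'' y'
    have e1 : s / g.M * (g.dist y y'' + r₀) * (CN / g.len y ^ 2 * Real.exp (-(δ₂ * g.dist y y''))) *
        (CG * g.len y'' ^ 2 * Real.exp (-(δ₂ * g.dist y'' y')) * Q y') =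
        (s / g.M * (g.dist y y'' + r₀) * (CN / g.len y ^ 2 * Real.exp (-(δ₂ * g.dist y y''))) *
          (CG * g.len y'' ^ 2 * Real.exp (-(δ₂ * g.dist y'' y')))) * Q y' := by ring
    rw [e1]
    exact mul_le_mul_of_nonneg_right ht (hQ y')
  have hKnn : 0 ≤ s / g.M * (CN * CG * g.L ^ 2 * (8 / δ₂ + r₀)) := by positivity
  calc ∑ y'' : g.Site, s / g.M * (g.dist y y'' + r₀) * (CN / g.len y ^ 2 * Real.exp (-(δ₂ * g.dist y y''))) *
          (CG * g.len y'' ^ 2 * Real.exp (-(δ₂ * g.dist y'' y')) * Q y')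
      ≤ ∑ y'' : g.Site, s / g.M * (CN * CG * g.L ^ 2 * (8 / δ₂ + r₀)) *
          (Real.exp (-(3 / 4 * δ₂ * g.dist y y'')) * Real.exp (-(3 / 4 * δ₂ * g.dist y'' y'))) * Q y' :=
        Finset.sum_le_sum fun y'' _ => hterm y''
    _ = s / g.M * (CN * CG * g.L ^ 2 * (8 / δ₂ + r₀)) *
          (∑ y'' : g.Site, Real.exp (-(3 / 4 * δ₂ * g.dist y y'')) * Real.exp (-(3 / 4 * δ₂ * g.dist y'' y'))) * Q y' := by
        rw [Finset.mul_sum, Finset.sum_mul]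
    _ ≤ s / g.M * (CN * CG * g.L ^ 2 * (8 / δ₂ + r₀)) * (c ^ 2 * Real.exp (-(1 / 2 * δ₂ * g.dist y y'))) * Q y' :=
        mul_le_mul_of_nonneg_right (mul_le_mul_of_nonneg_left (sum_le h263 y y') hKnn) (hQ y')
    _ = _ := by ring

/-- **LINE 3 OF (2.92) AGAINST AN ABSTRACT RIGHT FACTOR**: the domain change `D₃ = ζ_□(∂P∂* − ∂P_□∂*)h_□` with the sup majorant `C_De^{−c_DM}(L^jη)^{−2}e^{−δ₂d}`
and `X ≺_adm C_G·len²·e^{−δ₂d}·Q` give `D₃·X ≺_adm C_De^{−c_DM}·C_G·L²·c²·e^{−½δ₂d}·Q` (r03's `domLine_hasMajorant_h` on the class).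
[cite: Balaban1984PropagatorsII, (2.134) p.247 + (2.92) p.239 (line 3) + (2.141) p.247 + p.238] -/
theorem domLine_hasMajorantA (hL : 1 ≤ g.L) (hη : 0 < g.eta) (hsep : LevelSep g)
    (hd : ∀ a b, 0 ≤ g.dist a b) {δ₂ CD cD CG c : ℝ} (hδ₂ : 0 ≤ δ₂) (hCD : 0 ≤ CD) (hCG : 0 ≤ CG)
    (hRM : 0 ≤ g.R * g.M) (hthr : g.L ^ 2 ≤ Real.exp (1 / 8 * δ₂ * (g.R * g.M)))
    (h263 : Ineq263With c g (3 / 4 * δ₂) (1 / 3))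
    {D₃ XR : Module.End ℝ (X → ℝ)}
    (hD : HasMajorant blk D₃ fun y y'' => CD * Real.exp (-(cD * g.M)) / g.len y ^ 2 * Real.exp (-(δ₂ * g.dist y y'')))
    {Q : g.Site → ℝ} (hQ : ∀ y, 0 ≤ Q y) (hadm : ∀ (μ : X → ℝ) (y' : g.Site) (B : ℝ), adm μ y' B → 0 ≤ B)
    (hX : HasMajorantA blk adm XR fun y'' y' => CG * g.len y'' ^ 2 * Real.exp (-(δ₂ * g.dist y'' y')) * Q y') :
    HasMajorantA blk adm (D₃ * XR) fun y y' =>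
      CD * Real.exp (-(cD * g.M)) * CG * g.L ^ 2 * c ^ 2 * Real.exp (-(1 / 2 * δ₂ * g.dist y y')) * Q y' := by
  classical
  have hL0 : 0 < g.L := zero_lt_one.trans_le hL
  have hlen : ∀ z : g.Site, 0 < g.len z := fun z => mul_pos (pow_pos hL0 _) hη
  have hCP : 0 ≤ CD * Real.exp (-(cD * g.M)) := mul_nonneg hCD (Real.exp_nonneg _)
  have hKX : ∀ a b : g.Site, 0 ≤ CG * g.len a ^ 2 * Real.exp (-(δ₂ * g.dist a b)) * Q b := fun a b => by
    have := hQ b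
    positivity
  have hmul := hasMajorant_mul_hasMajorantA blk hD hX hKX hadm
  refine hasMajorantA_mono blk hmul hadm fun y y' => ?_
  have hterm : ∀ y'' : g.Site,
      CD * Real.exp (-(cD * g.M)) / g.len y ^ 2 * Real.exp (-(δ₂ * g.dist y y'')) *
        (CG * g.len y'' ^ 2 * Real.exp (-(δ₂ * g.dist y'' y')) * Q y') ≤
      CD * Real.exp (-(cD * g.M)) * CG * g.L ^ 2 *
        (Real.exp (-(3 / 4 * δ₂ * g.dist y y'')) * Real.exp (-(3 / 4 * δ₂ * g.dist y'' y'))) * Q y' := by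
    intro y''
    have hgap : (0 : ℝ) * g.M ≤ g.dist y y'' := by rw [zero_mul]; exact hd y y''
    have ht := term_le hL hη hsep hd hδ₂ hCP hCG hRM hthr y' hgap
    have e0 : Real.exp (-(1 / 8 * δ₂ * (0 * g.M))) = 1 := by simp
    rw [e0, mul_one] at ht
    have e1 : CD * Real.exp (-(cD * g.M)) / g.len y ^ 2 * Real.exp (-(δ₂ * g.dist y y'')) *
        (CG * g.len y'' ^ 2 * Real.exp (-(δ₂ * g.dist y'' y')) * Q y') =
        (CD * Real.exp (-(cD * g.M)) / g.len y ^ 2 * Real.exp (-(δ₂ * g.dist y y'')) *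
          (CG * g.len y'' ^ 2 * Real.exp (-(δ₂ * g.dist y'' y')))) * Q y' := by ring
    rw [e1]
    exact mul_le_mul_of_nonneg_right ht (hQ y')
  have hKnn : 0 ≤ CD * Real.exp (-(cD * g.M)) * CG * g.L ^ 2 := by positivity
  calc ∑ y'' : g.Site, CD * Real.exp (-(cD * g.M)) / g.len y ^ 2 * Real.exp (-(δ₂ * g.dist y y'')) *
          (CG * g.len y'' ^ 2 * Real.exp (-(δ₂ * g.dist y'' y')) * Q y')
      ≤ ∑ y'' : g.Site, CD * Real.exp (-(cD * g.M)) * CG * g.L ^ 2 *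
          (Real.exp (-(3 / 4 * δ₂ * g.dist y y'')) * Real.exp (-(3 / 4 * δ₂ * g.dist y'' y'))) * Q y' :=
        Finset.sum_le_sum fun y'' _ => hterm y''
    _ = CD * Real.exp (-(cD * g.M)) * CG * g.L ^ 2 *
          (∑ y'' : g.Site, Real.exp (-(3 / 4 * δ₂ * g.dist y y'')) * Real.exp (-(3 / 4 * δ₂ * g.dist y'' y'))) * Q y' := by
        rw [Finset.mul_sum, Finset.sum_mul]
    _ ≤ CD * Real.exp (-(cD * g.M)) * CG * g.L ^ 2 * (c ^ 2 * Real.exp (-(1 / 2 * δ₂ * g.dist y y'))) * Q y' :=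
        mul_le_mul_of_nonneg_right (mul_le_mul_of_nonneg_left (sum_le h263 y y') hKnn) (hQ y')
    _ = _ := by ring

/-- **(2.134), OFF-DIAGONAL PAIRS □ ≠ □′, AGAINST AN ABSTRACT RIGHT FACTOR**: with the (2.88)-shape majorant of `∂P∂*` (`hP`), the cut-off `|h′| ≤ 1` supported
within the blocks of the reach `S`, `|a| ≤ 1` (`a = h_□²(1 − ζ_{□′})`) vanishing on the blocks of the core `Score`, the gap `m·M` between `Scoreᶜ` and `S`,
(2.60) and `L² ≤ e^{⅛δ₂RM}`, (2.63) at rate ¾δ₂, α = ⅓, and `X ≺_adm C_G·len²·e^{−δ₂d}·Q`: `a·∂P∂*·(h′·X) ≺_adm C_P·C_G·L²·c²·e^{−⅛δ₂mM}·e^{−½δ₂d}·Q`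
(r03's `offDiag_hasMajorant` on the class; the output of `h′·X` is localised in `S` by `h′`, so the gap applies to every `y″`-term).
[cite: Balaban1984PropagatorsII, (2.134) p.247, (2.93) p.239, (2.88) p.238, (2.141) p.247] -/
theorem offDiag_hasMajorantA (hL : 1 ≤ g.L) (hη : 0 < g.eta) (hsep : LevelSep g)
    (hd : ∀ a b, 0 ≤ g.dist a b) {δ₂ CP CG c m : ℝ} (hδ₂ : 0 ≤ δ₂) (hCP : 0 ≤ CP) (hCG : 0 ≤ CG)
    (hRM : 0 ≤ g.R * g.M) (hthr : g.L ^ 2 ≤ Real.exp (1 / 8 * δ₂ * (g.R * g.M)))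
    (h263 : Ineq263With c g (3 / 4 * δ₂) (1 / 3))
    {DP XR : Module.End ℝ (X → ℝ)} {a hI : X → ℝ} {S Score : Set g.Site}
    (hP : HasMajorant blk DP fun y y'' => CP / g.len y ^ 2 * Real.exp (-(δ₂ * g.dist y y'')))
    (ha1 : ∀ x, |a x| ≤ 1) (haS : ∀ x, a x ≠ 0 → blk x ∉ Score)
    (hI1 : ∀ x, |hI x| ≤ 1) (hIS : ∀ x, hI x ≠ 0 → blk x ∈ S)
    (hgap : ∀ y y'', y ∉ Score → y'' ∈ S → m * g.M ≤ g.dist y y'')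
    {Q : g.Site → ℝ} (hQ : ∀ y, 0 ≤ Q y) (hadm : ∀ (μ : X → ℝ) (y' : g.Site) (B : ℝ), adm μ y' B → 0 ≤ B)
    (hX : HasMajorantA blk adm XR fun y'' y' => CG * g.len y'' ^ 2 * Real.exp (-(δ₂ * g.dist y'' y')) * Q y') :
    HasMajorantA blk adm (mulOp a * DP * (mulOp hI * XR)) fun y y' =>
      CP * CG * g.L ^ 2 * c ^ 2 * Real.exp (-(1 / 8 * δ₂ * (m * g.M))) * Real.exp (-(1 / 2 * δ₂ * g.dist y y')) * Q y' := by
  classical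
  have hL0 : 0 < g.L := zero_lt_one.trans_le hL
  have hlen : ∀ z : g.Site, 0 < g.len z := fun z => mul_pos (pow_pos hL0 _) hη
  have hKX : ∀ a b : g.Site, 0 ≤ CG * g.len a ^ 2 * Real.exp (-(δ₂ * g.dist a b)) * Q b := fun a b => by
    have := hQ b
    positivity
  have hKP : ∀ a b : g.Site, 0 ≤ CP / g.len a ^ 2 * Real.exp (-(δ₂ * g.dist a b)) := fun a b => by
    have := hlen a
    positivity
  -- (1) `h′·X`, its output localised in `S`
  have hS := hasMajorantA_localise_out blk (hasMajorantA_mulOp_left blk (f := hI) hI1 hX) (outLoc_mulOp_mul blk hIS XR)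
  have hSnn : ∀ a b : g.Site, 0 ≤ ind S a * (CG * g.len a ^ 2 * Real.exp (-(δ₂ * g.dist a b)) * Q b) :=
    fun a b => mul_nonneg (ind_nonneg _ _) (hKX a b)
  -- (2) composition with `∂P∂*` on the class
  have hPS := hasMajorant_mul_hasMajorantA blk hP hS hSnn hadm
  -- (3) the left factor `a` and the output localisation off the core
  have haT := hasMajorantA_mulOp_left blk (f := a) ha1 hPS
  have hout : OutLoc blk (mulOp a * (DP * (mulOp hI * XR))) Scoreᶜ := outLoc_mulOp_mul blk (fun x hx => haS x hx) _
  have e0 : mulOp a * DP * (mulOp hI * XR) = mulOp a * (DP * (mulOp hI * XR)) := by simp only [mul_assoc]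
  rw [e0]
  have hloc := hasMajorantA_localise_out blk haT hout
  -- (4) the pointwise bound of the localised majorant
  refine hasMajorantA_mono blk hloc hadm fun y y' => ?_
  set θ := CP * CG * g.L ^ 2 * c ^ 2 * Real.exp (-(1 / 8 * δ₂ * (m * g.M))) with hθ
  have hθnn : 0 ≤ θ := by positivity
  have hRHS : 0 ≤ θ * Real.exp (-(1 / 2 * δ₂ * g.dist y y')) * Q y' := by have := hQ y'; positivity
  by_cases hy : y ∈ Score
  · have h0 : ind Scoreᶜ y = 0 := ind_of_not_mem (by simpa using hy)
    rw [h0, zero_mul]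
    exact hRHS
  rw [ind_of_mem (show y ∈ Scoreᶜ from hy), one_mul]
  have hterm : ∀ y'' : g.Site, CP / g.len y ^ 2 * Real.exp (-(δ₂ * g.dist y y'')) *
      (ind S y'' * (CG * g.len y'' ^ 2 * Real.exp (-(δ₂ * g.dist y'' y')) * Q y')) ≤
      CP * CG * g.L ^ 2 * Real.exp (-(1 / 8 * δ₂ * (m * g.M))) *
        (Real.exp (-(3 / 4 * δ₂ * g.dist y y'')) * Real.exp (-(3 / 4 * δ₂ * g.dist y'' y'))) * Q y' := by
    intro y''
    by_cases hy'' : y'' ∈ S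
    · have hg := hgap y y'' hy hy''
      have ht := term_le hL hη hsep hd hδ₂ hCP hCG hRM hthr y' hg
      rw [ind_of_mem hy'', one_mul]
      have e1 : CP / g.len y ^ 2 * Real.exp (-(δ₂ * g.dist y y'')) * (CG * g.len y'' ^ 2 * Real.exp (-(δ₂ * g.dist y'' y')) * Q y') =
          (CP / g.len y ^ 2 * Real.exp (-(δ₂ * g.dist y y'')) * (CG * g.len y'' ^ 2 * Real.exp (-(δ₂ * g.dist y'' y')))) * Q y' := by ring
      rw [e1]
      exact mul_le_mul_of_nonneg_right ht (hQ y')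
    · rw [ind_of_not_mem hy'', zero_mul, mul_zero]
      have := hQ y'
      positivity
  calc ∑ y'' : g.Site, CP / g.len y ^ 2 * Real.exp (-(δ₂ * g.dist y y'')) *
          (ind S y'' * (CG * g.len y'' ^ 2 * Real.exp (-(δ₂ * g.dist y'' y')) * Q y'))
      ≤ ∑ y'' : g.Site, CP * CG * g.L ^ 2 * Real.exp (-(1 / 8 * δ₂ * (m * g.M))) *
          (Real.exp (-(3 / 4 * δ₂ * g.dist y y'')) * Real.exp (-(3 / 4 * δ₂ * g.dist y'' y'))) * Q y' :=
        Finset.sum_le_sum fun y'' _ => hterm y''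
    _ = CP * CG * g.L ^ 2 * Real.exp (-(1 / 8 * δ₂ * (m * g.M))) *
          (∑ y'' : g.Site, Real.exp (-(3 / 4 * δ₂ * g.dist y y'')) * Real.exp (-(3 / 4 * δ₂ * g.dist y'' y'))) * Q y' := by
        rw [Finset.mul_sum, Finset.sum_mul]
    _ ≤ CP * CG * g.L ^ 2 * Real.exp (-(1 / 8 * δ₂ * (m * g.M))) * (c ^ 2 * Real.exp (-(1 / 2 * δ₂ * g.dist y y'))) * Q y' :=
        mul_le_mul_of_nonneg_right (mul_le_mul_of_nonneg_left (sum_le h263 y y') (by positivity)) (hQ y')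
    _ = θ * Real.exp (-(1 / 2 * δ₂ * g.dist y y')) * Q y' := by rw [hθ]; ring

/-- **(2.134), DIAGONAL PAIRS □ = □′, AGAINST AN ABSTRACT RIGHT FACTOR** — the three lines together (r03's `diag_hasMajorant_inout` on the class, the line-1
first-order pieces as opaque letters): `(line 1 + lines 2,4 + line 3)·X ≺_adm θ_diag·e^{−½δ₂d}·Q`,
`θ_diag = (#D·θ_E + s₂C_G)/M + #K·(s/M)·C_NC_GL²(8/δ₂ + r₀)c² + C_De^{−c_DM}C_GL²c²`.
[cite: Balaban1984PropagatorsII, (2.134) p.247 + (2.92) p.239 + (2.141) p.247] -/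
theorem diag_hasMajorantA (hL : 1 ≤ g.L) (hη : 0 < g.eta) (hsep : LevelSep g)
    (hd : ∀ a b, 0 ≤ g.dist a b) {δ₂ CG CN CD cD c s s₂ θE r₀ : ℝ} (hδ₂ : 0 < δ₂) (hCG : 0 ≤ CG)
    (hCN : 0 ≤ CN) (hCD : 0 ≤ CD) (hs : 0 ≤ s) (hs₂ : 0 ≤ s₂) (hθE : 0 ≤ θE) (hr₀ : 0 ≤ r₀)
    (hM : 0 < g.M) (hRM : 0 ≤ g.R * g.M) (hthr : g.L ^ 2 ≤ Real.exp (1 / 8 * δ₂ * (g.R * g.M)))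
    (h263 : Ineq263With c g (3 / 4 * δ₂) (1 / 3))
    {D₃ XR : Module.End ℝ (X → ℝ)} {hI c₀ : X → ℝ} {T : Set g.Site}
    {ι : Type} (D : Finset ι) {E : ι → Module.End ℝ (X → ℝ)} {cf : ι → X → ℝ}
    {κ : Type} (DK : Finset κ) {N : κ → Module.End ℝ (X → ℝ)} {z : κ → X → ℝ}
    {Q : g.Site → ℝ} (hQ : ∀ y, 0 ≤ Q y) (hadm : ∀ (μ : X → ℝ) (y' : g.Site) (B : ℝ), adm μ y' B → 0 ≤ B)
    (hE : ∀ i ∈ D, HasMajorantA blk adm (mulOp (cf i) * E i * XR) fun y y' => θE / g.M * Real.exp (-(δ₂ * g.dist y y')) * Q y')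
    (hc₀ : ∀ x, |c₀ x| ≤ s₂ / (g.M * g.len (blk x) ^ 2))
    (hIT : ∀ x, hI x ≠ 0 → blk x ∈ T)
    (hLip : ∀ x x', |hI x' - hI x| ≤ s / g.M * (g.dist (blk x) (blk x') + r₀))
    (hNin : ∀ k ∈ DK, InMajorant blk (N k) T fun y y'' => CN / g.len y ^ 2 * Real.exp (-(δ₂ * g.dist y y'')))
    (hNout : ∀ k ∈ DK, ∀ (y'' : g.Site) (μ : X → ℝ) (B : ℝ), BlockSupp blk μ y'' B → ∀ x, blk x ∈ T →
      |N k μ x| ≤ CN / g.len (blk x) ^ 2 * Real.exp (-(δ₂ * g.dist (blk x) y'')) * B)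
    (hz : ∀ k ∈ DK, ∀ x, |z k x| ≤ 1)
    (hD : HasMajorant blk D₃ fun y y'' => CD * Real.exp (-(cD * g.M)) / g.len y ^ 2 * Real.exp (-(δ₂ * g.dist y y'')))
    (hX : HasMajorantA blk adm XR fun y'' y' => CG * g.len y'' ^ 2 * Real.exp (-(δ₂ * g.dist y'' y')) * Q y') :
    HasMajorantA blk adm
      (((∑ i ∈ D, mulOp (cf i) * E i - mulOp c₀) + (∑ k ∈ DK, mulOp (z k) * (N k * mulOp hI - mulOp hI * N k)) + D₃) * XR)
      fun y y' =>
        ((D.card * θE + s₂ * CG) / g.M + DK.card * (s / g.M * (CN * CG * g.L ^ 2 * (8 / δ₂ + r₀)) * c ^ 2) +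
            CD * Real.exp (-(cD * g.M)) * CG * g.L ^ 2 * c ^ 2) *
          Real.exp (-(1 / 2 * δ₂ * g.dist y y')) * Q y' := by
  classical
  have hL0 : 0 < g.L := zero_lt_one.trans_le hL
  rw [add_mul, add_mul, Finset.sum_mul]
  -- line 1
  have h1 := line1_hasMajorantA blk hL0 hη hM (δ₂ := δ₂) D hadm hE hc₀ hX
  -- lines 2, 4
  have h2 := hasMajorantA_finsetSum blk DK (fun k => mulOp (z k) * (N k * mulOp hI - mulOp hI * N k) * XR)
    (fun _ y y' => s / g.M * (CN * CG * g.L ^ 2 * (8 / δ₂ + r₀)) * c ^ 2 * Real.exp (-(1 / 2 * δ₂ * g.dist y y')) * Q y')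
    fun k hk => commLine_hasMajorantA blk hL hη hsep hd hδ₂ hCN hCG hs hr₀ hM hRM hthr h263 (hNin k hk) (hNout k hk) (hz k hk) hIT hLip hQ hadm hX
  -- line 3
  have h3 := domLine_hasMajorantA blk hL hη hsep hd hδ₂.le hCD hCG hRM hthr h263 hD hQ hadm hX
  refine hasMajorantA_mono blk (hasMajorantA_add blk (hasMajorantA_add blk h1 h2) h3) hadm fun y y' => ?_
  -- pointwise: the rate `δ₂` of line 1 is at least `½δ₂`; the commutator lines add up
  have hθ₁ : 0 ≤ (D.card * θE + s₂ * CG) / g.M := by positivity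
  have hrate : Real.exp (-(δ₂ * g.dist y y')) ≤ Real.exp (-(1 / 2 * δ₂ * g.dist y y')) := by
    apply Real.exp_le_exp.mpr
    have := hd y y'
    nlinarith
  have hl1 : (D.card * θE + s₂ * CG) / g.M * Real.exp (-(δ₂ * g.dist y y')) * Q y' ≤
      (D.card * θE + s₂ * CG) / g.M * Real.exp (-(1 / 2 * δ₂ * g.dist y y')) * Q y' :=
    mul_le_mul_of_nonneg_right (mul_le_mul_of_nonneg_left hrate hθ₁) (hQ y')
  show (D.card * θE + s₂ * CG) / g.M * Real.exp (-(δ₂ * g.dist y y')) * Q y' +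
      ∑ k ∈ DK, s / g.M * (CN * CG * g.L ^ 2 * (8 / δ₂ + r₀)) * c ^ 2 * Real.exp (-(1 / 2 * δ₂ * g.dist y y')) * Q y' +
      CD * Real.exp (-(cD * g.M)) * CG * g.L ^ 2 * c ^ 2 * Real.exp (-(1 / 2 * δ₂ * g.dist y y')) * Q y' ≤ _
  rw [Finset.sum_const, nsmul_eq_mul]
  have hQy := hQ y'
  nlinarith [hl1]

end Generic

/-! ## §2  The torus wrappers: ONE threshold, ONE constant on the genuine multi-level torus `geomTB D` -/

section Torus

variable {d ℓ : ℕ}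

/-- `a ≤ (a + 1)(b + 1)` for `a, b ≥ 0`. [folklore] -/
private theorem le_mul_succ_left {a b : ℝ} (ha : 0 ≤ a) (hb : 0 ≤ b) : a ≤ (a + 1) * (b + 1) := by nlinarith

/-- **(2.134) FOR THE DIAGONAL PAIRS ON THE TORUS, AGAINST AN ABSTRACT RIGHT FACTOR** (p38's `ineq2134_diag_torus_in` on an admissible class): (2.60), (2.63),
`L² ≤ e^{⅛δRM}` discharged (`…ineq263_geomTB`, `…thr_geomTB`, `…levelSepTB`); lines 2 and 4 folded into ONE commutator family indexed by `Option κ`; ONE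
threshold `M₀`, ONE constant `c`. [cite: Balaban1984PropagatorsII, (2.134) p.247; (2.92) p.239; (2.141) p.247; Lemma 2.1 (2.60), (2.63) p.234] -/
theorem ineq2134A_diag_torus (d ℓ : ℕ) {δ : ℝ} (hδ : 0 < δ) :
    ∃ M₀ c : ℝ, 0 < M₀ ∧ 0 ≤ c ∧
      ∀ {Mh k R : ℕ} {P : Fin (d + 1) → ℕ} (D : TDomains d ℓ Mh k P R), 1 ≤ Mh → (∀ μ, 1 ≤ P μ) → 2 * (ℓ + 1) ≤ R →
        M₀ ≤ ((ℓ : ℝ) + 1) * Mh → ∀ {X : Type} (blk : X → (geomTB D).Site) {adm : (X → ℝ) → (geomTB D).Site → ℝ → Prop}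
        (_ : ∀ (μ : X → ℝ) (y' : (geomTB D).Site) (B : ℝ), adm μ y' B → 0 ≤ B) {Q : (geomTB D).Site → ℝ} (_ : ∀ y, 0 ≤ Q y),
        ∀ {CG CN CD cD s s₂ θE r₀ : ℝ}, 0 ≤ CG → 0 ≤ CN → 0 ≤ CD → 0 ≤ s → 0 ≤ s₂ → 0 ≤ θE → 0 ≤ r₀ →
        ∀ {XR Pl D₃ : Module.End ℝ (X → ℝ)} {hI c₀ ζ : X → ℝ} {T : Set (geomTB D).Site}
          {ι : Type} (DE : Finset ι) {E : ι → Module.End ℝ (X → ℝ)} {cf : ι → X → ℝ}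
          {κ : Type} (DK : Finset κ) {N : κ → Module.End ℝ (X → ℝ)} {z : κ → X → ℝ},
          (∀ e ∈ DE, HasMajorantA blk adm (mulOp (cf e) * E e * XR)
            (fun y y' => θE / (geomTB D).M * Real.exp (-(δ * (geomTB D).dist y y')) * Q y')) →
          (∀ x, |c₀ x| ≤ s₂ / ((geomTB D).M * (geomTB D).len (blk x) ^ 2)) →
          (∀ x, hI x ≠ 0 → blk x ∈ T) →
          (∀ x x', |hI x' - hI x| ≤ s / (geomTB D).M * ((geomTB D).dist (blk x) (blk x') + r₀)) →
          (∀ k ∈ DK, InMajorant blk (N k) T (fun y y'' => CN / (geomTB D).len y ^ 2 * Real.exp (-(δ * (geomTB D).dist y y'')))) →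
          (∀ k ∈ DK, ∀ (y'' : (geomTB D).Site) (μ : X → ℝ) (B : ℝ), BlockSupp blk μ y'' B → ∀ x, blk x ∈ T →
            |N k μ x| ≤ CN / (geomTB D).len (blk x) ^ 2 * Real.exp (-(δ * (geomTB D).dist (blk x) y'')) * B) →
          (∀ k ∈ DK, ∀ x, |z k x| ≤ 1) →
          InMajorant blk Pl T (fun y y'' => CN / (geomTB D).len y ^ 2 * Real.exp (-(δ * (geomTB D).dist y y''))) →
          (∀ (y'' : (geomTB D).Site) (μ : X → ℝ) (B : ℝ), BlockSupp blk μ y'' B → ∀ x, blk x ∈ T →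
            |Pl μ x| ≤ CN / (geomTB D).len (blk x) ^ 2 * Real.exp (-(δ * (geomTB D).dist (blk x) y'')) * B) →
          (∀ x, |ζ x| ≤ 1) →
          HasMajorant blk D₃ (fun y y'' => CD * Real.exp (-(cD * (geomTB D).M)) / (geomTB D).len y ^ 2 * Real.exp (-(δ * (geomTB D).dist y y''))) →
          HasMajorantA blk adm XR (fun y'' y' => CG * (geomTB D).len y'' ^ 2 * Real.exp (-(δ * (geomTB D).dist y'' y')) * Q y') →
          HasMajorantA blk adm
            ((((∑ e ∈ DE, mulOp (cf e) * E e - mulOp c₀) +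
                ((∑ k ∈ DK, mulOp (z k) * (N k * mulOp hI - mulOp hI * N k)) + mulOp ζ * (Pl * mulOp hI - mulOp hI * Pl))) + D₃) * XR)
            (fun y y' =>
              ((DE.card * θE + s₂ * CG) / (geomTB D).M +
                    (DK.card + 1) * (s / (geomTB D).M * (CN * CG * (geomTB D).L ^ 2 * (8 / δ + r₀)) * c ^ 2) +
                  CD * Real.exp (-(cD * (geomTB D).M)) * CG * (geomTB D).L ^ 2 * c ^ 2) *
                Real.exp (-(1 / 2 * δ * (geomTB D).dist y y')) * Q y') := by
  classical
  obtain ⟨N₀, hN₀pos, h263⟩ := ineq263_geomTB d ℓ hδ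
  obtain ⟨N₂, hthr⟩ := thr_geomTB d ℓ hδ
  obtain ⟨c, hc⟩ : ∃ c : ℝ, c = K261 N₀ (d + 1) ((ℓ : ℝ) + 1) 1 (1 / 3 * (3 / 4 * δ)) := ⟨_, rfl⟩
  have hcnn : 0 ≤ c := by rw [hc]; exact K261_nonneg (by positivity) zero_le_one
  obtain ⟨M₀, hM₀⟩ : ∃ M₀ : ℝ, M₀ = max ((N₀ : ℝ) + 1) ((N₂ : ℝ) + 1) := ⟨_, rfl⟩
  refine ⟨M₀, c, by rw [hM₀]; exact lt_max_of_lt_left (by positivity), hcnn, ?_⟩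
  intro Mh k R P D hMh hP hR hM X blk adm hadm Q hQ CG CN CD cD s s₂ θE r₀ hCG hCN hCD hs hs₂ hθE hr₀ XR Pl D₃ hI c₀ ζ T ι DE E cf κ DK N z hE hc₀ hIT
    hLip hNin hNout hz hPlin hPlout hζ hD hX
  have hMN₀ : (N₀ : ℝ) + 1 ≤ ((ℓ : ℝ) + 1) * Mh := (le_max_left _ _).trans (hM₀ ▸ hM)
  have hMN₂ : (N₂ : ℝ) + 1 ≤ ((ℓ : ℝ) + 1) * Mh := (le_max_right _ _).trans (hM₀ ▸ hM)
  have hL1 := one_le_L_TB D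
  have hη := eta_pos_TB D
  have hMpos := M_pos_TB D hMh
  have hRM := RM_nonneg_TB D hMh hR
  have h263i : Ineq263With c (geomTB D) (3 / 4 * δ) (1 / 3) := by rw [hc]; exact h263 D hMh hP hR hMN₀
  -- lines 2 and 4 as ONE commutator family indexed by `Option κ`
  have hN'in : ∀ o ∈ Finset.insertNone DK, InMajorant blk ((fun o : Option κ => o.elim Pl N) o) T
      (fun y y'' => CN / (geomTB D).len y ^ 2 * Real.exp (-(δ * (geomTB D).dist y y''))) := by
    intro o ho
    cases o with
    | none => exact hPlin
    | some k => exact hNin k (Finset.some_mem_insertNone.1 ho)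
  have hN'out : ∀ o ∈ Finset.insertNone DK, ∀ (y'' : (geomTB D).Site) (μ : X → ℝ) (B : ℝ), BlockSupp blk μ y'' B → ∀ x, blk x ∈ T →
      |((fun o : Option κ => o.elim Pl N) o) μ x| ≤ CN / (geomTB D).len (blk x) ^ 2 * Real.exp (-(δ * (geomTB D).dist (blk x) y'')) * B := by
    intro o ho
    cases o with
    | none => exact hPlout
    | some k => exact hNout k (Finset.some_mem_insertNone.1 ho)
  have hz'le : ∀ o ∈ Finset.insertNone DK, ∀ x, |(fun o : Option κ => o.elim ζ z) o x| ≤ 1 := by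
    intro o ho x
    cases o with
    | none => exact hζ x
    | some k => exact hz k (Finset.some_mem_insertNone.1 ho) x
  have hsum : (∑ k ∈ DK, mulOp (z k) * (N k * mulOp hI - mulOp hI * N k)) + mulOp ζ * (Pl * mulOp hI - mulOp hI * Pl) =
      ∑ o ∈ Finset.insertNone DK,
        mulOp ((fun o : Option κ => o.elim ζ z) o) *
          ((fun o : Option κ => o.elim Pl N) o * mulOp hI - mulOp hI * (fun o : Option κ => o.elim Pl N) o) := by
    rw [Finset.sum_insertNone]
    exact add_comm _ _
  have key := diag_hasMajorantA blk hL1 hη (levelSepTB D hMh hP (one_le_RLMh hMh hR)) (dist_nonneg_TB D hMh hP) hδ hCG hCN hCD hs hs₂ hθE hr₀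
    hMpos hRM (hthr D hMh hR hMN₂) h263i DE (Finset.insertNone DK) (N := fun o : Option κ => o.elim Pl N) (z := fun o : Option κ => o.elim ζ z)
    hQ hadm hE hc₀ hIT hLip hN'in hN'out hz'le hD hX
  rw [hsum]
  refine hasMajorantA_mono _ key hadm fun y y' => le_of_eq ?_
  rw [Finset.card_insertNone]
  push_cast
  ring

/-- **(2.134) FOR `K_{□,□} = kDiag (∂P∂*) h_□ ζ_□ M_□ P_□` BY NAME, ON THE TORUS, AGAINST AN ABSTRACT RIGHT FACTOR, THE `O(M⁻¹)` PACKAGED**: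
`(K_{□,□}·G_□)·X′ ≺_adm Θ·U/M·e^{−(δ/2)d}·Q` with `U = (#E·θ_E + s₂C_G + (#K + 1)·s·((C_N + 1)C_G(1 + r₀)) + C_DC_G/c_D)` — here the composite `G_□·X′` is the
abstract right factor `XR` (p38's `ineq2134_kDiag_torus_theta_in` on the class; `hdec` rewrites `h_□M_□ − M_□h_□`).
[cite: Balaban1984PropagatorsII, (2.134) p.247; (2.92) p.239; (2.141) p.247; p.238 (remarks)] -/
theorem ineq2134A_kDiag_torus (d ℓ : ℕ) {δ : ℝ} (hδ : 0 < δ) :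
    ∃ M₀ Θ : ℝ, 0 < M₀ ∧ 0 ≤ Θ ∧
      ∀ {Mh k R : ℕ} {P : Fin (d + 1) → ℕ} (D : TDomains d ℓ Mh k P R), 1 ≤ Mh → (∀ μ, 1 ≤ P μ) → 2 * (ℓ + 1) ≤ R →
        M₀ ≤ ((ℓ : ℝ) + 1) * Mh → ∀ {X : Type} (blk : X → (geomTB D).Site) {adm : (X → ℝ) → (geomTB D).Site → ℝ → Prop}
        (_ : ∀ (μ : X → ℝ) (y' : (geomTB D).Site) (B : ℝ), adm μ y' B → 0 ≤ B) {Q : (geomTB D).Site → ℝ} (_ : ∀ y, 0 ≤ Q y)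
        (Dg : Module.End ℝ (X → ℝ)),
        ∀ {CG CN CD cD s s₂ θE r₀ : ℝ}, 0 ≤ CG → 0 ≤ CN → 0 ≤ CD → 0 < cD → 0 ≤ s → 0 ≤ s₂ → 0 ≤ θE → 0 ≤ r₀ →
        ∀ {Gl XR' Ml Pl : Module.End ℝ (X → ℝ)} {hI c₀ ζ : X → ℝ} {T : Set (geomTB D).Site}
          {ι : Type} (DE : Finset ι) {E : ι → Module.End ℝ (X → ℝ)} {cf : ι → X → ℝ}
          {κ : Type} (DK : Finset κ) {N : κ → Module.End ℝ (X → ℝ)} {z : κ → X → ℝ},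
          mulOp hI * Ml - Ml * mulOp hI =
            (∑ e ∈ DE, mulOp (cf e) * E e - mulOp c₀) + ∑ k ∈ DK, mulOp (z k) * (N k * mulOp hI - mulOp hI * N k) →
          (∀ e ∈ DE, HasMajorantA blk adm (mulOp (cf e) * E e * (Gl * XR'))
            (fun y y' => θE / (geomTB D).M * Real.exp (-(δ * (geomTB D).dist y y')) * Q y')) →
          (∀ x, |c₀ x| ≤ s₂ / ((geomTB D).M * (geomTB D).len (blk x) ^ 2)) →
          (∀ x, hI x ≠ 0 → blk x ∈ T) →
          (∀ x x', |hI x' - hI x| ≤ s / (geomTB D).M * ((geomTB D).dist (blk x) (blk x') + r₀)) →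
          (∀ k ∈ DK, InMajorant blk (N k) T (fun y y'' => CN / (geomTB D).len y ^ 2 * Real.exp (-(δ * (geomTB D).dist y y'')))) →
          (∀ k ∈ DK, ∀ (y'' : (geomTB D).Site) (μ : X → ℝ) (B : ℝ), BlockSupp blk μ y'' B → ∀ x, blk x ∈ T →
            |N k μ x| ≤ CN / (geomTB D).len (blk x) ^ 2 * Real.exp (-(δ * (geomTB D).dist (blk x) y'')) * B) →
          (∀ k ∈ DK, ∀ x, |z k x| ≤ 1) →
          InMajorant blk Pl T (fun y y'' => CN / (geomTB D).len y ^ 2 * Real.exp (-(δ * (geomTB D).dist y y''))) →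
          (∀ (y'' : (geomTB D).Site) (μ : X → ℝ) (B : ℝ), BlockSupp blk μ y'' B → ∀ x, blk x ∈ T →
            |Pl μ x| ≤ CN / (geomTB D).len (blk x) ^ 2 * Real.exp (-(δ * (geomTB D).dist (blk x) y'')) * B) →
          (∀ x, 0 ≤ ζ x) → (∀ x, ζ x ≤ 1) →
          HasMajorant blk (mulOp ζ * (Dg - Pl) * mulOp hI)
            (fun y y'' => CD * Real.exp (-(cD * (geomTB D).M)) / (geomTB D).len y ^ 2 * Real.exp (-(δ * (geomTB D).dist y y''))) →
          HasMajorantA blk adm (Gl * XR') (fun y'' y' => CG * (geomTB D).len y'' ^ 2 * Real.exp (-(δ * (geomTB D).dist y'' y')) * Q y') →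
          HasMajorantA blk adm ((kDiag Dg (mulOp hI) (mulOp ζ) Ml Pl * Gl) * XR')
            (fun y y' => Θ * (DE.card * θE + s₂ * CG + (DK.card + 1) * s * ((CN + 1) * CG * (1 + r₀)) + CD * CG / cD) *
              ((geomTB D).M)⁻¹ * Real.exp (-(δ / 2 * (geomTB D).dist y y')) * Q y') := by
  obtain ⟨M₀, c, hM₀, hc, hall⟩ := ineq2134A_diag_torus d ℓ hδ
  obtain ⟨Θ, hΘ⟩ : ∃ Θ : ℝ, Θ = ((ℓ : ℝ) + 1) ^ 2 * c ^ 2 * (0 + 1) * (8 / δ + 1) + 1 := ⟨_, rfl⟩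
  have hΘnn : 0 ≤ Θ := by rw [hΘ]; positivity
  refine ⟨M₀, Θ, hM₀, hΘnn, ?_⟩
  intro Mh k R P D hMh hP hR hM X blk adm hadm Q hQ Dg CG CN CD cD s s₂ θE r₀ hCG hCN hCD hcD hs hs₂ hθE hr₀ Gl XR' Ml Pl hI c₀ ζ T ι DE E cf κ DK N z
    hdec hE hc₀ hIT hLip hNin hNout hz hPlin hPlout hζ0 hζ1 hD hX
  have hMpos : 0 < (geomTB D).M := M_pos_TB D hMh
  have hζ : ∀ x, |ζ x| ≤ 1 := fun x => abs_le.2 ⟨by linarith [hζ0 x], hζ1 x⟩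
  have key := hall D hMh hP hR hM blk hadm hQ hCG hCN hCD hs hs₂ hθE hr₀ (XR := Gl * XR') (Pl := Pl) (D₃ := mulOp ζ * (Dg - Pl) * mulOp hI)
    (ζ := ζ) DE DK hE hc₀ hIT hLip hNin hNout hz hPlin hPlout hζ hD hX
  -- `kDiag` = line 1 + (line 2 + line 4) + line 3, by `hdec`
  have e : kDiag Dg (mulOp hI) (mulOp ζ) Ml Pl =
      ((∑ e ∈ DE, mulOp (cf e) * E e - mulOp c₀) +
          ((∑ k ∈ DK, mulOp (z k) * (N k * mulOp hI - mulOp hI * N k)) + mulOp ζ * (Pl * mulOp hI - mulOp hI * Pl))) +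
        mulOp ζ * (Dg - Pl) * mulOp hI := by
    unfold kDiag
    rw [hdec]
    abel
  rw [e, mul_assoc]
  refine hasMajorantA_mono _ key hadm fun y y' => ?_
  have hθ := theta_pack_le (L := (geomTB D).L) (c := c) (CP := 0) (CN' := CN) (s₁ := θE) (C₁ := 1) DE.card DK.card hMpos hδ le_rfl hCN
    (le_mul_succ_left hCN le_rfl) hCN hCG zero_le_one hCD hcD hs hθE hs₂ hr₀
  rw [geomTB_L] at hθ ⊢
  rw [← hΘ] at hθ
  have h1 : Real.exp (-(1 / 2 * δ * (geomTB D).dist y y')) = Real.exp (-(δ / 2 * (geomTB D).dist y y')) := by ring_nf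
  rw [h1, show (DE.card : ℝ) * θE = DE.card * (θE * 1) by ring]
  exact mul_le_mul_of_nonneg_right (mul_le_mul_of_nonneg_right hθ (Real.exp_nonneg _)) (hQ y')

/-- **(2.134) FOR THE OFF-DIAGONAL PAIRS ON THE TORUS, AGAINST AN ABSTRACT RIGHT FACTOR, THE `O(M⁻¹)` EXPLICIT** (p38/r03's `ineq2134_offDiag_torus` on
the class): `a·∂P∂*·(h′·X) ≺_adm Θ·C_P·C_G/(m·M)·e^{−(δ_G/2)d}·Q` above ONE threshold (`…offDiag_hasMajorantA` + r03's `theta_le` with §2's side facts).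
[cite: Balaban1984PropagatorsII, (2.134) p.247; (2.88) p.238; (2.93) p.239; (2.141) p.247; Lemma 2.1 p.234] -/
theorem ineq2134A_offDiag_torus (d ℓ : ℕ) {δG : ℝ} (hδG : 0 < δG) :
    ∃ M₀ Θ : ℝ, 0 < M₀ ∧ 0 ≤ Θ ∧
      ∀ {Mh k R : ℕ} {P : Fin (d + 1) → ℕ} (D : TDomains d ℓ Mh k P R), 1 ≤ Mh → (∀ μ, 1 ≤ P μ) → 2 * (ℓ + 1) ≤ R →
        M₀ ≤ ((ℓ : ℝ) + 1) * Mh → ∀ {X : Type} (blk : X → (geomTB D).Site) {adm : (X → ℝ) → (geomTB D).Site → ℝ → Prop}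
        (_ : ∀ (μ : X → ℝ) (y' : (geomTB D).Site) (B : ℝ), adm μ y' B → 0 ≤ B) {Q : (geomTB D).Site → ℝ} (_ : ∀ y, 0 ≤ Q y)
        {CP CG m : ℝ}, 0 ≤ CP → 0 ≤ CG → 0 < m →
        ∀ {Dg XR : Module.End ℝ (X → ℝ)} {a hI : X → ℝ} {S Score : Set (geomTB D).Site},
          HasMajorant blk Dg (fun y y'' => CP / (geomTB D).len y ^ 2 * Real.exp (-(δG * (geomTB D).dist y y''))) →
          (∀ x, |a x| ≤ 1) → (∀ x, a x ≠ 0 → blk x ∉ Score) → (∀ x, |hI x| ≤ 1) → (∀ x, hI x ≠ 0 → blk x ∈ S) →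
          (∀ y y'', y ∉ Score → y'' ∈ S → m * (geomTB D).M ≤ (geomTB D).dist y y'') →
          HasMajorantA blk adm XR (fun y'' y' => CG * (geomTB D).len y'' ^ 2 * Real.exp (-(δG * (geomTB D).dist y'' y')) * Q y') →
          HasMajorantA blk adm (mulOp a * Dg * (mulOp hI * XR))
            (fun y y' => Θ * CP * CG / m * ((geomTB D).M)⁻¹ * Real.exp (-(1 / 2 * δG * (geomTB D).dist y y')) * Q y') := by
  obtain ⟨N₀, hN₀pos, h263⟩ := ineq263_geomTB d ℓ hδG
  obtain ⟨N₂, hthr⟩ := thr_geomTB d ℓ hδG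
  obtain ⟨c, hc⟩ : ∃ c : ℝ, c = K261 N₀ (d + 1) ((ℓ : ℝ) + 1) 1 (1 / 3 * (3 / 4 * δG)) := ⟨_, rfl⟩
  obtain ⟨M₀, hM₀⟩ : ∃ M₀ : ℝ, M₀ = max ((N₀ : ℝ) + 1) ((N₂ : ℝ) + 1) := ⟨_, rfl⟩
  obtain ⟨Θ, hΘ⟩ : ∃ Θ : ℝ, Θ = 8 * ((ℓ : ℝ) + 1) ^ 2 * c ^ 2 / δG := ⟨_, rfl⟩
  have hΘnn : 0 ≤ Θ := by rw [hΘ]; positivity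
  refine ⟨M₀, Θ, by rw [hM₀]; exact lt_max_of_lt_left (by positivity), hΘnn, ?_⟩
  intro Mh k R P D hMh hP hR hM X blk adm hadm Q hQ CP CG m hCP hCG hm Dg XR a hI S Score hDg ha1 haS hI1 hIS hgap hX
  have hMN₀ : (N₀ : ℝ) + 1 ≤ ((ℓ : ℝ) + 1) * Mh := (le_max_left _ _).trans (hM₀ ▸ hM)
  have hMN₂ : (N₂ : ℝ) + 1 ≤ ((ℓ : ℝ) + 1) * Mh := (le_max_right _ _).trans (hM₀ ▸ hM)
  have hMpos := M_pos_TB D hMh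
  have h263D : Ineq263With c (geomTB D) (3 / 4 * δG) (1 / 3) := by rw [hc]; exact h263 D hMh hP hR hMN₀
  have key := offDiag_hasMajorantA blk (one_le_L_TB D) (eta_pos_TB D) (levelSepTB D hMh hP (one_le_RLMh hMh hR)) (dist_nonneg_TB D hMh hP)
    hδG.le hCP hCG (RM_nonneg_TB D hMh hR) (hthr D hMh hR hMN₂) h263D hDg ha1 haS hI1 hIS hgap hQ hadm hX
  refine hasMajorantA_mono _ key hadm fun y y' => ?_
  have hθ := theta_le (L := (geomTB D).L) (c := c) hδG hm hMpos hCP hCG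
  have hid : 8 * CP * CG * (geomTB D).L ^ 2 * c ^ 2 / (δG * m) = Θ * CP * CG / m := by rw [hΘ, geomTB_L]; field_simp
  rw [hid] at hθ
  exact mul_le_mul_of_nonneg_right (mul_le_mul_of_nonneg_right hθ (Real.exp_nonneg _)) (hQ y')

/-- algebra of multiplication operators: `h_□·h_□·(1 − ζ_{□′}) = (h_□²(1 − ζ_{□′}))·` as operators. [folklore] -/
private theorem mulOp_mul_mulOp_one_sub {X : Type} (h z : X → ℝ) : mulOp h * mulOp h * (1 - mulOp z) = mulOp (fun x => h x * h x * (1 - z x)) := by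
  refine LinearMap.ext fun v => funext fun x => ?_
  simp only [Module.End.mul_apply, LinearMap.sub_apply, Module.End.one_apply, Pi.sub_apply, mulOp_apply]
  ring

/-- `|h| ≤ 1`, `0 ≤ ζ ≤ 1` give `|h²(1 − ζ)| ≤ 1`. [cite: Balaban1984PropagatorsII, (2.36) p.229, (2.93) p.239, bookkeeping] -/
private theorem abs_sq_one_sub_le {h z : ℝ} (hh : |h| ≤ 1) (hz0 : 0 ≤ z) (hz1 : z ≤ 1) : |h * h * (1 - z)| ≤ 1 := by
  rw [abs_mul, abs_mul, abs_of_nonneg (by linarith : (0 : ℝ) ≤ 1 - z)]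
  nlinarith [abs_nonneg h, mul_nonneg (abs_nonneg h) (abs_nonneg h)]

/-- **(2.134) ON THE TORUS FOR `(K_{□,□′}·G_{□′})·X′` WITH `K_{□,□′} = kOff` OF (2.93) BY NAME, AGAINST AN ABSTRACT RIGHT FACTOR** (p38/r03's
`ineq2134_kOff_torus` on the class): the right factor of the theory is `X = G_{□′}·X′`, carrying the (2.133)-shape majorant `C_G·len²·e^{−δ_Gd}·Q`.
[cite: Balaban1984PropagatorsII, (2.134) p.247; (2.93) p.239; (2.36) p.229; (2.141) p.247] -/
theorem ineq2134A_kOff_torus (d ℓ : ℕ) {δG : ℝ} (hδG : 0 < δG) :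
    ∃ M₀ Θ : ℝ, 0 < M₀ ∧ 0 ≤ Θ ∧
      ∀ {Mh k R : ℕ} {P : Fin (d + 1) → ℕ} (D : TDomains d ℓ Mh k P R), 1 ≤ Mh → (∀ μ, 1 ≤ P μ) → 2 * (ℓ + 1) ≤ R →
        M₀ ≤ ((ℓ : ℝ) + 1) * Mh → ∀ {X : Type} (blk : X → (geomTB D).Site) {adm : (X → ℝ) → (geomTB D).Site → ℝ → Prop}
        (_ : ∀ (μ : X → ℝ) (y' : (geomTB D).Site) (B : ℝ), adm μ y' B → 0 ≤ B) {Q : (geomTB D).Site → ℝ} (_ : ∀ y, 0 ≤ Q y)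
        {CP CG m : ℝ}, 0 ≤ CP → 0 ≤ CG → 0 < m →
        ∀ {Dg Gl XR' : Module.End ℝ (X → ℝ)} {h z h' : X → ℝ} {S Score : Set (geomTB D).Site},
          HasMajorant blk Dg (fun y y'' => CP / (geomTB D).len y ^ 2 * Real.exp (-(δG * (geomTB D).dist y y''))) →
          (∀ x, |h x| ≤ 1) → (∀ x, 0 ≤ z x) → (∀ x, z x ≤ 1) → (∀ x, z x ≠ 1 → blk x ∉ Score) →
          (∀ x, |h' x| ≤ 1) → (∀ x, h' x ≠ 0 → blk x ∈ S) →
          (∀ y y'', y ∉ Score → y'' ∈ S → m * (geomTB D).M ≤ (geomTB D).dist y y'') →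
          HasMajorantA blk adm (Gl * XR') (fun y'' y' => CG * (geomTB D).len y'' ^ 2 * Real.exp (-(δG * (geomTB D).dist y'' y')) * Q y') →
          HasMajorantA blk adm ((kOff Dg (mulOp h) (mulOp z) (mulOp h') * Gl) * XR')
            (fun y y' => Θ * CP * CG / m * ((geomTB D).M)⁻¹ * Real.exp (-(δG / 2 * (geomTB D).dist y y')) * Q y') := by
  obtain ⟨M₀, Θ, hM₀, hΘ, hall⟩ := ineq2134A_offDiag_torus d ℓ hδG
  refine ⟨M₀, Θ, hM₀, hΘ, ?_⟩
  intro Mh k R P D hMh hP hR hM X blk adm hadm Q hQ CP CG m hCP hCG hm Dg Gl XR' h z h' S Score hDg hh hz0 hz1 hzS hh' hh'S hgap hX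
  have ha1 : ∀ x, |h x * h x * (1 - z x)| ≤ 1 := fun x => abs_sq_one_sub_le (hh x) (hz0 x) (hz1 x)
  have haS : ∀ x, h x * h x * (1 - z x) ≠ 0 → blk x ∉ Score := fun x hx =>
    hzS x fun hz => hx (by rw [hz, sub_self, mul_zero])
  have key := hall D hMh hP hR hM blk hadm hQ hCP hCG hm (Dg := Dg) (XR := Gl * XR') (S := S) hDg ha1 haS hh' hh'S hgap hX
  have e : (kOff Dg (mulOp h) (mulOp z) (mulOp h') * Gl) * XR' =
      mulOp (fun x => h x * h x * (1 - z x)) * Dg * (mulOp h' * (Gl * XR')) := by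
    unfold kOff
    rw [mulOp_mul_mulOp_one_sub]
    simp only [mul_assoc]
  rw [e]
  refine hasMajorantA_mono _ key hadm fun y y' => le_of_eq ?_
  congr 2
  ring

/-- **(2.134) FOR THE WHOLE (2.91)-FAMILY ON THE TORUS, AGAINST A FAMILY OF ABSTRACT RIGHT FACTORS** (p38's `h2134_kFam_torus_in` on the class): for every
pair of cubes, `(K_{□,□′}·G_{□′})·X′_{□′} ≺_adm Θ·(C_PC_G/m + U)/M·e^{−(δ_G/2)d(y,y′)}·Q(y′)`,
`U = nE·θ_E + s₂C_G + (nK + 1)·s·((C_N + 1)C_G(1 + r₀)) + C_DC_G/c_D`, ONE threshold `M₀`, ONE `Θ` (on `d, L, δ_G`) — GIVEN, per cube: the member's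
`hdec` of `h_□M_□ − M_□h_□`, the line-1 `E`-letters against `G_□·X′_□`, the sizes/supports of `c₀`, the block-Lipschitz `h_□` supported within the blocks
of `S_□ ⊆ T_□`, the partners `N_k`, `P_□` In/Out-localised over `T_□`, the cut-offs `ζ_□ ∈ [0,1]` equal to `1` on the blocks of the core, line 3's majorant,
the gap `m·M`, and the (2.133)-shape majorant of `G_□·X′_□` on the class.
[cite: Balaban1984PropagatorsII, (2.134)–(2.135) p.247; (2.133) p.247; (2.91)–(2.93) p.239; (2.141) p.247] -/
theorem h2134A_kFam_torus (d ℓ : ℕ) {δG : ℝ} (hδG : 0 < δG) :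
    ∃ M₀ Θ : ℝ, 0 < M₀ ∧ 0 ≤ Θ ∧
      ∀ {Mh k R : ℕ} {P : Fin (d + 1) → ℕ} (D : TDomains d ℓ Mh k P R), 1 ≤ Mh → (∀ μ, 1 ≤ P μ) → 2 * (ℓ + 1) ≤ R →
        M₀ ≤ ((ℓ : ℝ) + 1) * Mh → ∀ {X : Type} (blk : X → (geomTB D).Site) {adm : (X → ℝ) → (geomTB D).Site → ℝ → Prop}
        (_ : ∀ (μ : X → ℝ) (y' : (geomTB D).Site) (B : ℝ), adm μ y' B → 0 ≤ B) {Q : (geomTB D).Site → ℝ} (_ : ∀ y, 0 ≤ Q y)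
        {Dg : Module.End ℝ (X → ℝ)} {CP : ℝ}, 0 ≤ CP →
        HasMajorant blk Dg (fun y y'' => CP / (geomTB D).len y ^ 2 * Real.exp (-(δG * (geomTB D).dist y y''))) →
        ∀ {CG CN CD cD s s₂ θE r₀ m : ℝ}, 0 ≤ CG → 0 ≤ CN → 0 ≤ CD → 0 < cD → 0 ≤ s → 0 ≤ s₂ → 0 ≤ θE → 0 ≤ r₀ → 0 < m →
        ∀ (nE nK : ℕ) {C : Type} [DecidableEq C] (Dc : Finset C) {G Ml Pl XR' : C → Module.End ℝ (X → ℝ)} {h ζ c₀ : C → X → ℝ}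
          {T S Score : C → Set (geomTB D).Site}
          {ι : Type} {DE : C → Finset ι} {E : C → ι → Module.End ℝ (X → ℝ)} {cf : C → ι → X → ℝ}
          {κ : Type} {DK : C → Finset κ} {N : C → κ → Module.End ℝ (X → ℝ)} {z : C → κ → X → ℝ},
          (∀ c ∈ Dc, (DE c).card ≤ nE) → (∀ c ∈ Dc, (DK c).card ≤ nK) →
          (∀ c ∈ Dc, mulOp (h c) * Ml c - Ml c * mulOp (h c) =
            (∑ e ∈ DE c, mulOp (cf c e) * E c e - mulOp (c₀ c)) + ∑ k ∈ DK c, mulOp (z c k) * (N c k * mulOp (h c) - mulOp (h c) * N c k)) →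
          (∀ c ∈ Dc, ∀ e ∈ DE c, HasMajorantA blk adm (mulOp (cf c e) * E c e * (G c * XR' c))
            (fun y y' => θE / (geomTB D).M * Real.exp (-(δG * (geomTB D).dist y y')) * Q y')) →
          (∀ c ∈ Dc, ∀ x, |c₀ c x| ≤ s₂ / ((geomTB D).M * (geomTB D).len (blk x) ^ 2)) →
          (∀ c ∈ Dc, ∀ x, |h c x| ≤ 1) → (∀ c ∈ Dc, ∀ x, h c x ≠ 0 → blk x ∈ S c) → (∀ c ∈ Dc, S c ⊆ T c) →
          (∀ c ∈ Dc, ∀ x x', |h c x' - h c x| ≤ s / (geomTB D).M * ((geomTB D).dist (blk x) (blk x') + r₀)) →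
          (∀ c ∈ Dc, ∀ k ∈ DK c,
            InMajorant blk (N c k) (T c) (fun y y'' => CN / (geomTB D).len y ^ 2 * Real.exp (-(δG * (geomTB D).dist y y'')))) →
          (∀ c ∈ Dc, ∀ k ∈ DK c, ∀ (y'' : (geomTB D).Site) (μ : X → ℝ) (B : ℝ), BlockSupp blk μ y'' B → ∀ x, blk x ∈ T c →
            |N c k μ x| ≤ CN / (geomTB D).len (blk x) ^ 2 * Real.exp (-(δG * (geomTB D).dist (blk x) y'')) * B) →
          (∀ c ∈ Dc, ∀ k ∈ DK c, ∀ x, |z c k x| ≤ 1) →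
          (∀ c ∈ Dc, InMajorant blk (Pl c) (T c) (fun y y'' => CN / (geomTB D).len y ^ 2 * Real.exp (-(δG * (geomTB D).dist y y'')))) →
          (∀ c ∈ Dc, ∀ (y'' : (geomTB D).Site) (μ : X → ℝ) (B : ℝ), BlockSupp blk μ y'' B → ∀ x, blk x ∈ T c →
            |Pl c μ x| ≤ CN / (geomTB D).len (blk x) ^ 2 * Real.exp (-(δG * (geomTB D).dist (blk x) y'')) * B) →
          (∀ c ∈ Dc, ∀ x, 0 ≤ ζ c x) → (∀ c ∈ Dc, ∀ x, ζ c x ≤ 1) → (∀ c ∈ Dc, ∀ x, ζ c x ≠ 1 → blk x ∉ Score c) →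
          (∀ c ∈ Dc, HasMajorant blk (mulOp (ζ c) * (Dg - Pl c) * mulOp (h c))
            (fun y y'' => CD * Real.exp (-(cD * (geomTB D).M)) / (geomTB D).len y ^ 2 * Real.exp (-(δG * (geomTB D).dist y y'')))) →
          (∀ c ∈ Dc, ∀ y y'', y ∉ Score c → y'' ∈ S c → m * (geomTB D).M ≤ (geomTB D).dist y y'') →
          (∀ c ∈ Dc, HasMajorantA blk adm (G c * XR' c)
            (fun y'' y' => CG * (geomTB D).len y'' ^ 2 * Real.exp (-(δG * (geomTB D).dist y'' y')) * Q y')) →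
          ∀ c ∈ Dc, ∀ c' ∈ Dc,
            HasMajorantA blk adm
              ((kFam Dg (fun c => mulOp (h c)) (fun c => mulOp (ζ c)) Ml Pl c c' * G c') * XR' c')
              (fun y y' => Θ * (CP * CG / m + (nE * θE + s₂ * CG + (nK + 1) * s * ((CN + 1) * CG * (1 + r₀)) + CD * CG / cD)) *
                ((geomTB D).M)⁻¹ * Real.exp (-(δG / 2 * (geomTB D).dist y y')) * Q y') := by
  obtain ⟨M₁, Θ₁, hM₁, hΘ₁, hoff⟩ := ineq2134A_kOff_torus d ℓ hδG
  obtain ⟨M₂, Θ₂, hM₂, hΘ₂, hdiag⟩ := ineq2134A_kDiag_torus d ℓ hδG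
  refine ⟨max M₁ M₂, max Θ₁ Θ₂, lt_max_of_lt_left hM₁, le_max_of_le_left hΘ₁, ?_⟩
  intro Mh k R P D hMh hP hR hM X blk adm hadm Q hQ Dg CP hCP hDg CG CN CD cD s s₂ θE r₀ m hCG hCN hCD hcD hs hs₂ hθE hr₀ hm nE nK C _ Dc G Ml Pl XR'
    h ζ c₀ T S Score ι DE E cf κ DK N z hnE hnK hdec hE hc₀ hh1 hhS hST hLip hNin hNout hz hPlin hPlout hζ0 hζ1 hζS hD3 hgap hX c hc c' hc'
  have hMi1 : M₁ ≤ ((ℓ : ℝ) + 1) * Mh := (le_max_left _ _).trans hM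
  have hMi2 : M₂ ≤ ((ℓ : ℝ) + 1) * Mh := (le_max_right _ _).trans hM
  have hMpos : 0 < (geomTB D).M := M_pos_TB D hMh
  have hMinv : 0 ≤ ((geomTB D).M)⁻¹ := inv_nonneg.2 hMpos.le
  set U : ℝ := nE * θE + s₂ * CG + (nK + 1) * s * ((CN + 1) * CG * (1 + r₀)) + CD * CG / cD with hU
  have hUnn : 0 ≤ U := by rw [hU]; positivity
  have hCGm : 0 ≤ CP * CG / m := div_nonneg (mul_nonneg hCP hCG) hm.le
  -- the common kernel dominates both packs
  have hdom : ∀ {θ : ℝ} (y y' : (geomTB D).Site), 0 ≤ θ → θ ≤ max Θ₁ Θ₂ * (CP * CG / m + U) →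
      θ * ((geomTB D).M)⁻¹ * Real.exp (-(δG / 2 * (geomTB D).dist y y')) * Q y' ≤
        max Θ₁ Θ₂ * (CP * CG / m + U) * ((geomTB D).M)⁻¹ * Real.exp (-(δG / 2 * (geomTB D).dist y y')) * Q y' := by
    intro θ y y' hθ hθle
    exact mul_le_mul_of_nonneg_right (mul_le_mul_of_nonneg_right (mul_le_mul_of_nonneg_right hθle hMinv) (Real.exp_nonneg _)) (hQ y')
  by_cases hcc : c = c'
  · -- the diagonal pair: (2.92), `kDiag`
    subst hcc
    have e : kFam Dg (fun c => mulOp (h c)) (fun c => mulOp (ζ c)) Ml Pl c c = kDiag Dg (mulOp (h c)) (mulOp (ζ c)) (Ml c) (Pl c) := by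
      simp [kFam]
    rw [e]
    have hhT : ∀ x, h c x ≠ 0 → blk x ∈ T c := fun x hx => hST c hc (hhS c hc x hx)
    have key := hdiag D hMh hP hR hMi2 blk hadm hQ Dg hCG hCN hCD hcD hs hs₂ hθE hr₀ (Gl := G c) (XR' := XR' c) (DE c) (DK c) (hdec c hc) (hE c hc)
      (hc₀ c hc) hhT (hLip c hc) (hNin c hc) (hNout c hc) (hz c hc) (hPlin c hc) (hPlout c hc) (hζ0 c hc) (hζ1 c hc) (hD3 c hc) (hX c hc)
    refine hasMajorantA_mono _ key hadm fun y y' => ?_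
    have hUc : (((DE c).card : ℝ) * θE + s₂ * CG + ((DK c).card + 1) * s * ((CN + 1) * CG * (1 + r₀)) + CD * CG / cD) ≤ U := by
      have h1 : ((DE c).card : ℝ) ≤ nE := by exact_mod_cast hnE c hc
      have h2 : ((DK c).card : ℝ) ≤ nK := by exact_mod_cast hnK c hc
      have h4 : 0 ≤ s * ((CN + 1) * CG * (1 + r₀)) := by positivity
      rw [hU]; nlinarith
    have hUc0 : 0 ≤ (((DE c).card : ℝ) * θE + s₂ * CG + ((DK c).card + 1) * s * ((CN + 1) * CG * (1 + r₀)) + CD * CG / cD) := by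
      positivity
    refine hdom y y' (mul_nonneg hΘ₂ hUc0) ?_
    calc Θ₂ * (((DE c).card : ℝ) * θE + s₂ * CG + ((DK c).card + 1) * s * ((CN + 1) * CG * (1 + r₀)) + CD * CG / cD)
        ≤ max Θ₁ Θ₂ * U := mul_le_mul (le_max_right _ _) hUc hUc0 (le_max_of_le_left hΘ₁)
      _ ≤ max Θ₁ Θ₂ * (CP * CG / m + U) := mul_le_mul_of_nonneg_left (by linarith) (le_max_of_le_left hΘ₁)
  · -- an off-diagonal pair: (2.93), `kOff`
    have e : kFam Dg (fun c => mulOp (h c)) (fun c => mulOp (ζ c)) Ml Pl c c' = kOff Dg (mulOp (h c)) (mulOp (ζ c')) (mulOp (h c')) := by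
      simp [kFam, hcc]
    rw [e]
    have key := hoff D hMh hP hR hMi1 blk hadm hQ hCP hCG hm (Dg := Dg) (Gl := G c') (XR' := XR' c') hDg (hh1 c hc) (hζ0 c' hc') (hζ1 c' hc')
      (hζS c' hc') (hh1 c' hc') (hhS c' hc') (hgap c' hc') (hX c' hc')
    refine hasMajorantA_mono _ key hadm fun y y' => ?_
    have e2 : Θ₁ * CP * CG / m * ((geomTB D).M)⁻¹ = Θ₁ * (CP * CG / m) * ((geomTB D).M)⁻¹ := by ring
    rw [e2]
    refine hdom y y' (mul_nonneg hΘ₁ hCGm) ?_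
    calc Θ₁ * (CP * CG / m) ≤ max Θ₁ Θ₂ * (CP * CG / m) := mul_le_mul_of_nonneg_right (le_max_left _ _) hCGm
      _ ≤ max Θ₁ Θ₂ * (CP * CG / m + U) := mul_le_mul_of_nonneg_left (by linarith) (le_max_of_le_left hΘ₁)

end Torus

end

end Literature.MathematicalPhysics.QuantumFieldTheory.Balaban1983to89.B6Ineq2134RightFactorA
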